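import Literature.NumberTheory.EllipticCurves.EisensteinNewformLevelRaisingCuspFormLiftProofs
import HarnessLib

/-!
# Billerey–Menares 2016, Thm. 2.2: the exact-nebentypus cuspidal lift from ONE integral form with
# the right constant terms (proofs only)

Topic `Literature/NumberTheory/EllipticCurves`; namespace
`Literature.NumberTheory.EllipticCurves.ModularForms.CuspFormLift`.  THEOREMS ONLY (no definition,
no named fact; D-0026).

The tail of the argument of `EisensteinNewformLevelRaisingCuspFormLiftProofs` isolated as a lemma
with an abstract input: if `H ∈ M_k(Γ₁(NM))` is `Γ₀(NM)`-equivariant with the character `χ`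
(modulo `N`), has `p`-integral `q`-expansion at `∞`, and its constant terms along `SL₂(ℤ)` are
`e χ(d_γ)` at the cusps with `N ∣ c_γ`, `M ∤ c_γ` and `0` elsewhere, for a `p`-adic UNIT `e`,
then — provided all constant terms of `E = eisensteinLevelRaised N k χ M` lie in `𝔪` —
`f₀ = E - (c₁/e) H` is a cusp form in `S_k(NM, χ)` with `aₙ(f₀) ≡ aₙ(E) (mod 𝔪)`
(`exists_cuspForm_nebentypus_congr_of_integralForm`).  This is the form in which the hypothesis
`hC` of `BillereyMenares2016_thm22_exists_newform_of_cuspidalCongruence` is supplied by explicit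
Eisenstein products (`EisensteinNewformLevelRaisingWashingtonProofs`), with no geometric input.

## References

* N. Billerey, R. Menares, *On the modularity of reducible mod `l` Galois representations*, Math.
  Res. Lett. 23 (2016), §2, Thm. 2.2 and its proof (p. 7). [BillereyMenares2016]
* N. Billerey, R. Menares, *Strong modularity of reducible Galois representations*, Trans. AMS 370
  (2018), §3.2. [BillereyMenares2018]
-/

noncomputable section

open scoped MatrixGroups ModularForm Topology
open CongruenceSubgroup UpperHalfPlane Filter Matrix.SpecialLinearGroup ConjAct Pointwise

namespace Literature.NumberTheory.EllipticCurves.ModularForms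

namespace CuspFormLift

variable {p : ℕ} [Fact p.Prime]

open Classical in
set_option maxHeartbeats 800000 in
/-- **The exact-nebentypus cuspidal lift of `E - E(M·)` from one integral form with the right
constant terms.**  For `ι : ℚ̄_p ≃ ℂ`, `χ` modulo `N`, `k ≥ 3`, a
prime `M ∤ N`, a form `H ∈ M_k(Γ₁(NM))` with `H ∣[k] γ = χ(d_γ) H` on `Γ₀(NM)`, `p`-integral
`q`-expansion and constant terms `e χ(d_γ) [N ∣ c_γ, M ∤ c_γ]` along `SL₂(ℤ)` (`e` a `p`-adic unit),
if all constant terms of `E = eisensteinLevelRaised N k χ M` lie in `𝔪` then some `f₀ ∈ S_k(NM, χ)`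
has `aₙ(f₀) ≡ aₙ(E) (mod 𝔪)` for all `n` (`f₀ = E - (c₁/e) H`).
[cite: BillereyMenares2016, §2, proof of Thm. 2.2 (p. 7)] [cite: BillereyMenares2018, §3.2] -/
theorem exists_cuspForm_nebentypus_congr_of_integralForm
    (ι : PadicAlgCl p ≃+* ℂ) {N : ℕ} [NeZero N] (χ : DirichletCharacter ℂ N)
    (k : ℕ) (hk : 3 ≤ k) (M : ℕ) [NeZero M] (hM : M.Prime) (hMN : ¬ M ∣ N)
    (hcusp : ∀ γ : SL(2, ℤ), ∃ c : ℂ,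
      Tendsto ((⇑(eisensteinLevelRaised N k χ M hk) : ℍ → ℂ) ∣[(k : ℤ)] γ) atImInfty (𝓝 c) ∧
        Valued.v (ι.symm c) < 1)
    (H : ModularForm (Gamma1 (N * M)) k)
    (hHslash : ∀ γ : SL(2, ℤ), γ ∈ Gamma0 (N * M) →
      (⇑H : ℍ → ℂ) ∣[(k : ℤ)] γ = χ ((γ 1 1 : ℤ) : ZMod N) • ⇑H)
    (hHint : ∀ n : ℕ, Valued.v (ι.symm ((qExpansion 1 (⇑H : ℍ → ℂ)).coeff n)) ≤ 1)
    (e : ℂ) (he : Valued.v (ι.symm e) = 1)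
    (hHct : ∀ γ : SL(2, ℤ), Tendsto ((⇑H : ℍ → ℂ) ∣[(k : ℤ)] γ) atImInfty
      (𝓝 (if (N : ℤ) ∣ γ 1 0 ∧ ¬ (M : ℤ) ∣ γ 1 0 then e * χ ((γ 1 1 : ℤ) : ZMod N) else 0))) :
    ∃ f₀ : CuspForm (Gamma1 (N * M)) k,
      f₀ ∈ nebentypusSubspace (N * M) k (DirichletCharacter.changeLevel (dvd_mul_right N M) χ) ∧
      ∀ n, Valued.v (ι.symm (cuspCoeff f₀ n -
        (qExpansion 1 ⇑(eisensteinLevelRaised N k χ M hk)).coeff n)) < 1 := by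
  haveI : NeZero (N * M) := ⟨mul_ne_zero (NeZero.ne N) (NeZero.ne M)⟩
  have hMN' : M.Coprime N := (Nat.Prime.coprime_iff_not_dvd hM).2 hMN
  have he0 : e ≠ 0 := by
    intro h0
    rw [h0, map_zero, Valuation.map_zero] at he
    exact zero_ne_one he
  set χL := DirichletCharacter.changeLevel (dvd_mul_right N M) χ with hχL
  set E := eisensteinLevelRaised N k χ M hk with hE
  -- ### constant terms of `E`
  set c₁ : ℂ := (-(Literature.NumberTheory.LFunctions.generalizedBernoulli k χ) / (4 * k)) *
    ((1 + χ (-1) * (-1) ^ (k : ℤ)) * (1 - χ⁻¹ (M : ZMod N) * (M : ℂ) ^ (-(k : ℤ)))) with hc₁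
  have hEct : ∀ γ : SL(2, ℤ), Tendsto ((⇑E : ℍ → ℂ) ∣[(k : ℤ)] γ) atImInfty
      (𝓝 (if (N : ℤ) ∣ γ 1 0 ∧ ¬ (M : ℤ) ∣ γ 1 0 then c₁ * χ ((γ 1 1 : ℤ) : ZMod N) else 0)) := by
    intro γ
    by_cases hMc : (M : ℤ) ∣ γ 1 0
    · rw [if_neg fun h ↦ h.2 hMc]
      exact tendsto_eisensteinLevelRaised_slash_atImInfty_of_dvd k χ M hk hMN' hMc
    · have hprime : Prime (M : ℤ) := Nat.prime_iff_prime_int.mp hM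
      have hcop : IsCoprime (γ 1 0) (M : ℤ) :=
        ((Irreducible.coprime_iff_not_dvd hprime.irreducible).2 hMc).symm
      have h := tendsto_eisensteinLevelRaised_slash_atImInfty_of_isCoprime k χ M hk hMN' hcop
      by_cases hNc : (N : ℤ) ∣ γ 1 0
      · rw [if_pos ⟨hNc, hMc⟩]
        rw [if_pos ((ZMod.intCast_zmod_eq_zero_iff_dvd _ _).2 hNc)] at h
        convert h using 2
        rw [hc₁]; ring
      · rw [if_neg fun h' ↦ hNc h'.1]
        rwa [if_neg fun h' ↦ hNc ((ZMod.intCast_zmod_eq_zero_iff_dvd _ _).1 h'), mul_zero] at h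
  -- ### `c₁ ∈ 𝔪` (the constant term at `γ₁ = (1 0; N 1)`)
  have hdet : Matrix.det !![(1 : ℤ), 0; (N : ℤ), 1] = 1 := by
    rw [Matrix.det_fin_two_of]; ring
  set γ₁ : SL(2, ℤ) := ⟨!![(1 : ℤ), 0; (N : ℤ), 1], hdet⟩ with hγ₁def
  have hc₁v : Valued.v (ι.symm c₁) < 1 := by
    obtain ⟨c, hc, hcv⟩ := hcusp γ₁
    have h1 := hEct γ₁
    have h10 : (γ₁ 1 0 : ℤ) = N := by simp [hγ₁def]
    have h11 : (γ₁ 1 1 : ℤ) = 1 := by simp [hγ₁def]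
    have hP1 : (N : ℤ) ∣ γ₁ 1 0 ∧ ¬ (M : ℤ) ∣ γ₁ 1 0 := by
      rw [h10]
      exact ⟨dvd_rfl, fun h ↦ hMN (Int.natCast_dvd_natCast.mp h)⟩
    rw [if_pos hP1, h11, Int.cast_one, map_one, mul_one] at h1
    rwa [tendsto_nhds_unique hc h1] at hcv
  -- ### `F = E - (c₁/e) H` has vanishing constant terms
  set F : ModularForm (Gamma1 (N * M)) k := E - (c₁ / e) • H with hFdef
  have hFcoe : (⇑F : ℍ → ℂ) = ⇑E - (c₁ / e) • ⇑H := by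
    rw [hFdef, ModularForm.coe_sub, ModularForm.IsGLPos.coe_smul]
  have hFct : ∀ γ : SL(2, ℤ), Tendsto ((⇑F : ℍ → ℂ) ∣[(k : ℤ)] γ) atImInfty (𝓝 0) := by
    intro γ
    rw [hFcoe, sub_smul_slash_SL2]
    have h := (hEct γ).sub ((hHct γ).const_smul (c₁ / e))
    have h0 : (if (N : ℤ) ∣ γ 1 0 ∧ ¬ (M : ℤ) ∣ γ 1 0 then c₁ * χ ((γ 1 1 : ℤ) : ZMod N) else 0) -
        (c₁ / e) • (if (N : ℤ) ∣ γ 1 0 ∧ ¬ (M : ℤ) ∣ γ 1 0 then e * χ ((γ 1 1 : ℤ) : ZMod N)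
          else 0) = 0 := by
      split_ifs
      · rw [smul_eq_mul]; field_simp; ring
      · simp
    rwa [h0] at h
  -- ### the cusp form `f₀`
  let f₀ : CuspForm (Gamma1 (N * M)) k :=
    { toFun := ⇑F
      slash_action_eq' := F.slash_action_eq'
      holo' := F.holo'
      zero_at_cusps' := fun {c} hc ↦ by
        rw [Subgroup.IsArithmetic.isCusp_iff_isCusp_SL2Z] at hc
        rw [OnePoint.isZeroAt_iff_forall_SL2Z hc]
        intro γ _
        have h := hFct γ
        rw [ModularForm.SL_slash] at h
        exact h }
  have hcoe : (⇑f₀ : ℍ → ℂ) = ⇑F := rfl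
  -- ### `χ_L` on `Γ₀(NM)` is `χ(d_γ)`
  have hχLγ : ∀ γ : Gamma0 (N * M),
      χL (Gamma0Map (N * M) γ) = χ ((((γ : SL(2, ℤ)) 1 1 : ℤ)) : ZMod N) := by
    intro γ
    have hcop : IsCoprime (((γ : SL(2, ℤ)) 1 1 : ℤ)) ((N * M : ℕ) : ℤ) := by
      have hdet' := Matrix.SpecialLinearGroup.det_coe (γ : SL(2, ℤ))
      rw [Matrix.det_fin_two] at hdet'
      have hc : ((N * M : ℕ) : ℤ) ∣ (γ : SL(2, ℤ)) 1 0 := by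
        have h0 := Gamma0_mem.mp γ.2
        rwa [ZMod.intCast_zmod_eq_zero_iff_dvd] at h0
      obtain ⟨e', he'⟩ := hc
      refine ⟨(γ : SL(2, ℤ)) 0 0, -((γ : SL(2, ℤ)) 0 1 * e'), ?_⟩
      linear_combination hdet' + ((γ : SL(2, ℤ)) 0 1) * he'
    have h := DirichletCharacter.changeLevel_eq_cast_of_dvd' χ (dvd_mul_right N M) hcop
    rw [hχL]
    exact h
  refine ⟨f₀, ?_, fun n ↦ ?_⟩
  · -- ### nebentypus `χ_L`
    refine mem_nebentypusSubspace_of_forall_slash fun γ ↦ ?_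
    change (⇑F : ℍ → ℂ) ∣[(k : ℤ)] ((γ : SL(2, ℤ)) : GL (Fin 2) ℝ) = χL (Gamma0Map (N * M) γ) • ⇑F
    rw [← ModularForm.SL_slash, hFcoe, sub_smul_slash_SL2,
      eisensteinLevelRaised_slash_of_mem_gamma0 k χ M hk γ.2, hHslash _ γ.2, hχLγ,
      smul_sub, smul_comm]
  · -- ### the congruence `aₙ(f₀) - aₙ(E) = -(c₁/e) aₙ(H) ∈ 𝔪`
    have hq : qExpansion 1 (⇑f₀ : ℍ → ℂ) =
        qExpansion 1 (⇑E : ℍ → ℂ) - (c₁ / e) • qExpansion 1 (⇑H : ℍ → ℂ) := by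
      rw [hcoe, hFdef, ModularForm.coe_sub,
        ModularForm.qExpansion_sub one_pos (HeckeTGamma1.one_mem_strictPeriods_Gamma1 (N * M)) E
          ((c₁ / e) • H),
        ModularForm.IsGLPos.coe_smul,
        ModularForm.qExpansion_smul one_pos (HeckeTGamma1.one_mem_strictPeriods_Gamma1 (N * M))]
    have hdiff : (PowerSeries.coeff n) (qExpansion 1 (⇑E : ℍ → ℂ) -
        (c₁ / e) • qExpansion 1 (⇑H : ℍ → ℂ)) - (PowerSeries.coeff n) (qExpansion 1 (⇑E : ℍ → ℂ)) =
        -((c₁ / e) * (PowerSeries.coeff n) (qExpansion 1 (⇑H : ℍ → ℂ))) := by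
      rw [map_sub, PowerSeries.coeff_smul, smul_eq_mul]
      ring
    rw [cuspCoeff, hq, hdiff, map_neg, Valuation.map_neg, map_mul, Valuation.map_mul]
    have h2 : Valued.v (ι.symm (c₁ / e)) < 1 := by
      rw [map_div₀, map_div₀, he, div_one]
      exact hc₁v
    calc Valued.v (ι.symm (c₁ / e)) * Valued.v (ι.symm ((PowerSeries.coeff n) (qExpansion 1 (⇑H : ℍ → ℂ))))
        ≤ Valued.v (ι.symm (c₁ / e)) * 1 := mul_le_mul' le_rfl (hHint n)
      _ < 1 := by rw [mul_one]; exact h2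

end CuspFormLift

end Literature.NumberTheory.EllipticCurves.ModularForms
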